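import Summits.BirchSwinnertonDyer.BirchSwinnertonDyer.Theorems.PrintCf2RubinValueTwoColemanCoinvariantCharTraceEllipticUnitsFrameDischargedSplit
import Summits.BirchSwinnertonDyer.BirchSwinnertonDyer.Theorems.PrintCf2RubinValueTwoColemanCoinvariantCharTraceEllipticUnitsResidualWitnesses
import HarnessLib

/-!
# Brick (c) at `p = 2`: the (c)-capstone T15-split WITH DE SHALIT'S RESIDUAL BINDERS DISCHARGED — the auxiliary indices `a₁ a₂` (with
# `γ w hγ hv₁ hn₁π hne hn₂ hv₂ hv₂'`), the Amice consequences `hn₁ hg₁ hg₂`, and THE divided series `L` with its relation `hL` are now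
# SUPPLIED (memo v12 (M1)); the only residual input is ONE non-zero Galois trace of a Coates–Wiles moment of `e(𝔞₁)` (`hmom`)

Cell `bsd-print-cf2`, width seat `bsd-line-cf2c-w7` g31, route C `PrintCf2RubinValueTwo`, crux of record stmt-BirchSwinnertonDyer-24033
`TwoVariableMainConjAtSplitTwoQuad` (23720 nominal), BRICK §4(c); `--supports` the crux as a helper.  THEOREMS ONLY (0 sorry, no named fact
asserted, no definition); CONDITIONAL on the published named facts `DeShalit1987.prop24_ii/iii`, `prop25_i` carried as hypotheses by the
elliptic-unit files.  Theses-free.  BSD is not proved by any of this.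

T15-split (`…FrameDischargedSplit.exists_frame_…_of_split`) displays, after its Coleman frame, the RESIDUAL binders of de Shalit II §4.12:
`γ w hγ`, `a₁ a₂ hv₁ hn₁ hg₁ hg₂ hn₁π hne hn₂ hv₂ hv₂'`, `mm kk hεk hmom`, `L hL`.  THIS file moves all but `mm kk hεk hmom` into the
existential prefix, for EVERY Amice datum `(g, s)` of the lifts `σ̃_𝔞` (hypothesis `hg`, the shape of `…ColemanCoinvariantCharTraceArtin`;
such data exist by `exists_amicePair_galois`):
* (A) the indices by the PRINCIPAL road of `…ResidualWitnesses.exists_principal_witnesses` — `a₁ = (α₁)`, `α₁ = 1 + 4β ≡ 1 mod 𝔤₀v̄^ν·v̄`,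
  `γ := χ_π(σ̃_{a₁}) = α₁ = 1 + π²w`; `a₂ = (ϱ)`, `ϱ = 1 + N(𝔤₀v̄^{ν+1}) ∈ ℕ`, `N a₂ = ϱ² = χ_π(σ̃_{a₂})²`, `χ_π(σ̃_{a₂}) ≠ ±1`; `π² ∣ N a₁ − 1`,
  `N a₁ ≠ γ²` — no class-number-one input;
* (B) `hg₁ hg₂ hn₁` from the Amice hypothesis (`constantCoeff_eq_one_of_amice`, `natCast_mul_inv_sub_one_mem_maximalIdeal`);
* (C) **`L` with `hL`** — `φ_ε(Σ_j Col⟨e(𝔟)⟩(j)) = (t_{χ(σ̃_𝔟)}·C g_𝔟 − N𝔟)·L` for every liftable `𝔟` — by the existence form of the trace capstone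
  `…ColemanCoinvariantTraceArtin.exists_charIdeal_coinvariants_colemanImageTrace_closure_eq_span_of_mul_rule` (product rule of the elliptic
  units, layer approximation of the liftable lifts, `ha₂` by the kernel theorem `maxEval_twistFactor_ne_zero_of_natCast_eq_pow`).

* ★★★ `exists_frame_charIdeal_coinvariants_colemanImageTrace_closure_ellipticUnits_eq_span_of_split_residualDischarged` — conclusion, for all
  free data: `∃ α₁ ϱ a₁ a₂ γ w L (…side conditions…) (hL), ∀ mm kk (hεk) (hmom), char_Λ((N_Σ/Col_Σ 𝒞̄_ell)_ε) = (L)`.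

HONEST RESIDUAL: `hmom` — one level `mm` and one weight `kk ≡ parity(ε)` with a non-zero Galois trace of the `kk`-th Coates–Wiles moment of
`e(𝔞₁)` (II §4.9–4.10: an explicit multiple of a partial Hecke `L`-value); it is NOT discharged here.

## References
* [deShalit1987] E. de Shalit, *Iwasawa theory of elliptic curves with complex multiplication* (1987), I §3.1, §3.5 (11); II §1.10, §2.4 (ii),
  §4.9–4.10, §4.12 (29)–(33), §4.14, §4.17; III §1.3, §1.4 (5), Cor. 1.5, Lemma 1.10 (17).
* [NeukirchANT1999] J. Neukirch, *Algebraic Number Theory* (1999), Ch. I §2, §8 Prop. (8.3); Ch. VI §5 Prop. (5.6), §7 Thm. (7.1).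
* [Serre1973CourseArithmetic] J.-P. Serre, *A Course in Arithmetic* (1973), Ch. II §3.2 Thm. 3, §3.3.
* [Washington1997] L. C. Washington, *Introduction to Cyclotomic Fields* (1997), §7.1, §13.2.
-/

noncomputable section

set_option linter.dupNamespace false
set_option autoImplicit false

open Filter Topology
open scoped PowerSeries.WithPiTopology
open scoped NumberField Classical

namespace Summit.BirchSwinnertonDyer.BirchSwinnertonDyer.Theorems.PrintCf2.ColemanCoinvariantTraceEllipticUnitsResidualDischarged

open Field IsDedekindDomain IsDedekindDomain.HeightOneSpectrum ValuativeRel WithZero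
open Literature.NumberTheory.NumberFields
open Literature.NumberTheory.GaloisRepresentations Literature.NumberTheory.GaloisRepresentations.IsNonarchimedeanLocalField
  Literature.NumberTheory.GaloisRepresentations.LubinTate Literature.NumberTheory.GaloisRepresentations.ArtinLocalGlobal
open Literature.NumberTheory.EllipticCurves
open Literature.NumberTheory.ComplexMultiplication.EllipticUnits
open Literature.NumberTheory.LFunctions.AbelianDensity (artinSymbol)
open Literature.RingTheory.PowerSeries (maxEval)
open Summit.BirchSwinnertonDyer.BirchSwinnertonDyer.Theorems.PrintCf2.ColemanImage
open Summit.BirchSwinnertonDyer.BirchSwinnertonDyer.Theorems.PrintCf2.ColemanCoinvariantGalois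
open Summit.BirchSwinnertonDyer.BirchSwinnertonDyer.Theorems.PrintCf2.ColemanCoinvariantArtin
open Summit.BirchSwinnertonDyer.BirchSwinnertonDyer.Theorems.PrintCf2.EllipticUnitsLocal
open Summit.BirchSwinnertonDyer.BirchSwinnertonDyer.Theorems.PrintCf2.EllipticUnitsLocal₂
open Summit.BirchSwinnertonDyer.BirchSwinnertonDyer.Theorems.PrintCf2.ColemanCoinvariantEllipticUnits
open Summit.BirchSwinnertonDyer.BirchSwinnertonDyer.Theorems.PrintCf2.ColemanCoinvariantEllipticUnitsLiftable
open Summit.BirchSwinnertonDyer.BirchSwinnertonDyer.Theorems.PrintCf2.ColemanCoinvariantTrace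
open Summit.BirchSwinnertonDyer.BirchSwinnertonDyer.Theorems.PrintCf2.ColemanCoinvariantTraceArtin
open Summit.BirchSwinnertonDyer.BirchSwinnertonDyer.Theorems.PrintCf2.ColemanCoinvariantTraceEllipticUnits
open Summit.BirchSwinnertonDyer.BirchSwinnertonDyer.Theorems.PrintCf2.ColemanCoinvariantTraceEllipticUnitsTowerDataOffset
open Summit.BirchSwinnertonDyer.BirchSwinnertonDyer.Theorems.PrintCf2.ColemanCoinvariantTraceEllipticUnitsTowerDataOffsetIndex
open Summit.BirchSwinnertonDyer.BirchSwinnertonDyer.Theorems.PrintCf2.ColemanCoinvariantTraceEllipticUnitsTowerDataOffsetMoment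
open Summit.BirchSwinnertonDyer.BirchSwinnertonDyer.Theorems.PrintCf2.ColemanCoinvariantTraceEllipticUnitsTowerDataOffsetLevelEllipticMoment
open Summit.BirchSwinnertonDyer.BirchSwinnertonDyer.Theorems.PrintCf2.ColemanCoinvariantTraceEllipticUnitsFrameDischarged
open Summit.BirchSwinnertonDyer.BirchSwinnertonDyer.Theorems.PrintCf2.ColemanCoinvariantTraceEllipticUnitsFrameDischargedSplit
open Summit.BirchSwinnertonDyer.BirchSwinnertonDyer.Theorems.PrintCf2.ColemanCoinvariantTraceEllipticUnitsResidualWitnesses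

variable {K : Type} [Field K] [NumberField K] {𝔤₀ : Ideal (𝓞 K)} {v v' : HeightOneSpectrum (𝓞 K)}

attribute [local instance] ltNormUniformSpace ltNormIsUniformAddGroup rk1 nF nE fintypeResidueField
attribute [local instance] RelNormCoherentUnits.instCommMonoid

/-- `v ∤ 𝔤₀v'^ν` for `v ∤ 𝔤₀`, `v ≠ v'`. [cite: deShalit1987, II.4.14 (p. 71)] -/
private theorem not_mul_pow_le₃₄ (hv : ¬ 𝔤₀ ≤ v.asIdeal) (hvv' : v' ≠ v) (n : ℕ) : ¬ 𝔤₀ * v'.asIdeal ^ n ≤ v.asIdeal := by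
  intro h
  rcases (v.isPrime.mul_le).mp h with h1 | h2
  · exact hv h1
  · rcases n with _ | n
    · rw [pow_zero, Ideal.one_eq_top, top_le_iff] at h2
      exact v.isPrime.ne_top h2
    · exact hvv' (HeightOneSpectrum.ext ((v'.isMaximal.eq_of_le v.isPrime.ne_top ((Ideal.IsPrime.pow_le_iff (hP := v.isPrime)
        (Nat.succ_ne_zero n)).mp h2))))

section Capstone

attribute [local instance] isAdicComplete_maximalIdeal_powerSeries_integer

variable [NumberField.IsTotallyComplex K]
  (h24iii : DeShalit1987.prop24_iii_unit) (h25 : DeShalit1987.prop25_i_normRelation) (h24ii : DeShalit1987.prop24_ii_galoisAction)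

set_option maxHeartbeats 1600000 in
include h24iii h25 h24ii in
/-- ★★★ **THE (c)-CAPSTONE WITH ITS FRAME, ITS AUXILIARY INDICES AND ITS DIVIDED SERIES `L` ALL SUPPLIED.**  For `K` imaginary quadratic of ODD
class number, `2 ∈ v`, `2 ∈ v̄`, `v̄ ≠ v`, a conductor `𝔤₀ ≠ 0` prime to `v, v̄` with `2 ∉ 𝔤₀`: there is a Coleman frame (as in T15-split) such
that for every unramified tower `E_j`, normal generators `θ`, theta families `x`, local lifts `σ̃` (`hσ`), sign `ε`, and EVERY Amice datum `(g, s)` of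
the lifts (`hg`), THERE ARE de Shalit's auxiliary indices `a₁ = (α₁)`, `a₂ = (ϱ)` (`α₁ ≡ 1 mod 𝔤₀v̄^ν·v̄`, `γ := χ_π(σ̃_{a₁}) = α₁ = 1 + π²w`,
`π² ∣ N a₁ − 1`, `N a₁ ≠ γ²`; `ϱ ∈ ℕ`, `N a₂ = χ_π(σ̃_{a₂})²`, `χ_π(σ̃_{a₂}) ≠ ±1`) AND the series `L ∈ Λ = 𝒪_v⟦X⟧⟦T⟧` with
`φ_ε(Σ_j Col⟨e(𝔟)⟩(j)) = (t_{χ(σ̃_𝔟)}·C g_𝔟 − N𝔟)·L` for every liftable `𝔟` (de Shalit II §4.12 (29)–(33), §4.14 Step 1), such that ONE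
non-zero Galois trace of a Coates–Wiles moment of `e(𝔞₁)` of the right parity (`hεk`, `hmom`) gives **`char_Λ((N_Σ/Col_Σ 𝒞̄_ell)_ε) = (L)`**.
[cite: deShalit1987, I §3.1, §3.5 (11); II §1.10, §2.4 (ii), §4.9–4.10, §4.12 (29)–(33), §4.14, §4.17; III §1.3, §1.4 (5), Cor. 1.5, Lemma 1.10 (17)]
[cite: NeukirchANT1999, Ch. I §2, §8 Prop. (8.3); Ch. VI §5 Prop. (5.6), §7 Thm. (7.1)] [cite: Serre1973CourseArithmetic, Ch. II §3.2 Thm. 3, §3.3] -/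
theorem exists_frame_charIdeal_coinvariants_colemanImageTrace_closure_ellipticUnits_eq_span_of_split_residualDischarged
    (hK : IsImaginaryQuadratic K) (ιK : K →+* ℂ)
    (h𝔤0 : 𝔤₀ ≠ ⊥) (hv : ¬ 𝔤₀ ≤ v.asIdeal) (hv' : ¬ 𝔤₀ ≤ v'.asIdeal) (hvv' : v' ≠ v) (h2𝔤 : (2 : 𝓞 K) ∉ 𝔤₀)
    {p : ℕ} [hp : Fact p.Prime] (hp2 : p = 2) (hpv : (p : 𝓞 K) ∈ v.asIdeal) (hpv' : (p : 𝓞 K) ∈ v'.asIdeal)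
    (hcl : ¬ 2 ∣ NumberField.classNumber K) :
    ∃ (hw𝔤 : ∀ u : (𝓞 K)ˣ, (u : 𝓞 K) - 1 ∈ 𝔤₀ → u = 1) (hdeg1 : Nat.card (𝓞 K ⧸ v'.asIdeal) = p) (hpv'2 : (p : 𝓞 K) ∉ v'.asIdeal ^ 2)
      (_ : CharZero (v.adicCompletion K)) (σ₀ : absoluteGaloisGroup (v.adicCompletion K)) (hσ₀ : IsAbsArithFrob σ₀)
      (hq : residueFieldCard (v.adicCompletion K) = 2)
      (_ : IsAdicComplete (Ideal.span {(p : 𝒪[v.adicCompletion K])}) 𝒪[v.adicCompletion K])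
      (hI : Ideal.span {(p : 𝒪[v.adicCompletion K])} ≠ ⊤) (hN : DenseRange (Nat.cast : ℕ → 𝒪[v.adicCompletion K]))
      (π : 𝒪[v.adicCompletion K]) (hπ : (valuation (v.adicCompletion K)).IsUniformizer (π : v.adicCompletion K))
      (α : 𝓞 K) (hα0 : α ≠ 0) (hα𝔤 : α - 1 ∈ 𝔤₀) (hαw : ∀ w : HeightOneSpectrum (𝓞 K), w ≠ v → α ∉ w.asIdeal)
      (f : ℕ) (hαf : Ideal.span {α} = v.asIdeal ^ f) (hαπ : ((α : K) : v.adicCompletion K) = (π : v.adicCompletion K) ^ f)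
      (ℓ ν : ℕ) (hℓ : 1 ≤ ℓ) (hαℓ : v'.intValuation (α - 1) = exp (-(ℓ : ℤ)))
      (ha2 : 2 ≤ ν + 1 ∨ p ≠ 2) (hαa : v'.intValuation (α ^ p - 1) = exp (-((ν + 1 : ℕ) : ℤ)))
      (d₀ r : ℕ) (hd : d₀.Coprime p) (hf : f = d₀ * p ^ r) (hfo : f ∣ orderOf (galFrob K (rayClassField K (𝔤₀ * v'.asIdeal ^ ν)) v))
      (u : (LTCoeff (v.adicCompletion K))ˣ) (hu : LTCoeff.of (v.adicCompletion K) π = residueFieldCard (v.adicCompletion K) * u)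
      (_ : NeZero d₀)
      (_ : ∃ m₁ : ℕ, LTCoeff.of (v.adicCompletion K) π ^ 2 ∣ LTCoeff.of (v.adicCompletion K) π - m₁),
    ∀ (E : ℕ → IntermediateField (v.adicCompletion K) (AlgebraicClosure (v.adicCompletion K)))
      [∀ j, FiniteDimensional (v.adicCompletion K) (E j)] [∀ j, Normal (v.adicCompletion K) (E j)] [∀ j, IsGalois (v.adicCompletion K) (E j)]
      (hmono : Monotone E) (hE : ∀ j, E j ≤ maxUnramified (v.adicCompletion K)) (hdeg : ∀ j, Module.finrank (v.adicCompletion K) (E j) = d₀ * p ^ j)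
      [IsAdicComplete (Ideal.span {intBase (v.adicCompletion K) (LTCoeff.of (v.adicCompletion K) π)}) (PowerSeries 𝒪[v.adicCompletion K])]
      {θ : ∀ j, unitBall (E j)} (hθ : ∀ j, IsIntegralNormalGen (E j) (θ j))
      (hcoh : ∀ j, unitBallTrace (hmono (Nat.le_succ j)) (θ (j + 1)) = θ j)
      (hud : ∀ j, (u : LTCoeff (v.adicCompletion K)) ^ Module.finrank (v.adicCompletion K) (E j) ≠ 1)
      (x : ∀ a : {𝔞 : Ideal (𝓞 K) // IsLocArtinLiftable (𝔤₀ * v'.asIdeal ^ ν) v v' 𝔞}, ∀ i k : ℕ,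
        rayClassField K (𝔤₀ * v'.asIdeal ^ ν * v'.asIdeal ^ (i + 1) * v.asIdeal ^ (k + 1)))
      (hx : ∀ a, ∀ i k : ℕ, IsThetaValueOne ιK (𝔤₀ * v'.asIdeal ^ ν * v'.asIdeal ^ (i + 1) * v.asIdeal ^ (k + 1)) (a.1 : Ideal (𝓞 K))
        (algClosureEmb ιK ((x a i k : rayClassField K (𝔤₀ * v'.asIdeal ^ ν * v'.asIdeal ^ (i + 1) * v.asIdeal ^ (k + 1))) : AlgebraicClosure K)))
      (σ : {𝔞 : Ideal (𝓞 K) // IsLocArtinLiftable (𝔤₀ * v'.asIdeal ^ ν) v v' 𝔞} → absoluteGaloisGroup (v.adicCompletion K))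
      (hσ : ∀ a, ∀ i k : ℕ, absRestrictNormalHom (rayClassField K (𝔤₀ * v'.asIdeal ^ ν * v'.asIdeal ^ (i + 1) * v.asIdeal ^ (k + 1)))
          (absGaloisRestrict K (v.adicCompletion K) (σ a)) =
        artinSymbol (galFrob K (rayClassField K (𝔤₀ * v'.asIdeal ^ ν * v'.asIdeal ^ (i + 1) * v.asIdeal ^ (k + 1)))) (a.1 : Ideal (𝓞 K)))
      (ε : PowerSeries (PowerSeries 𝒪[v.adicCompletion K]))
      (g : {𝔞 : Ideal (𝓞 K) // IsLocArtinLiftable (𝔤₀ * v'.asIdeal ^ ν) v v' 𝔞} → (PowerSeries 𝒪[v.adicCompletion K])ˣ)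
      (s : {𝔞 : Ideal (𝓞 K) // IsLocArtinLiftable (𝔤₀ * v'.asIdeal ^ ν) v v' 𝔞} → ZMod d₀)
      (hg : ∀ b : {𝔞 : Ideal (𝓞 K) // IsLocArtinLiftable (𝔤₀ * v'.asIdeal ^ ν) v v' 𝔞}, ∀ j : ℕ, ∃ a : ℕ,
        (∀ z : E j, σ b • (z : AlgebraicClosure (v.adicCompletion K)) = (σ₀ ^ a) • (z : AlgebraicClosure (v.adicCompletion K))) ∧
        ((1 + PowerSeries.X : PowerSeries 𝒪[v.adicCompletion K]) ^ p ^ j - 1) ∣ (g b : PowerSeries 𝒪[v.adicCompletion K]) - (1 + PowerSeries.X) ^ a ∧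
        (a : ZMod d₀) = s b)
      (hε : ε * ε = 1),
    ∃ (α₁ : 𝓞 K) (ϱ : ℕ) (a₁ a₂ : {𝔞 : Ideal (𝓞 K) // IsLocArtinLiftable (𝔤₀ * v'.asIdeal ^ ν) v v' 𝔞}) (γ w : 𝒪[v.adicCompletion K]ˣ)
      (L : PowerSeries (PowerSeries 𝒪[v.adicCompletion K]))
      (_ : (a₁.1 : Ideal (𝓞 K)) = Ideal.span {α₁}) (_ : α₁ - 1 ∈ 𝔤₀ * v'.asIdeal ^ ν * v'.asIdeal)
      (_ : (a₂.1 : Ideal (𝓞 K)) = Ideal.span {(ϱ : 𝓞 K)}) (_ : (ϱ : 𝓞 K) - 1 ∈ 𝔤₀ * v'.asIdeal ^ ν * v'.asIdeal)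
      (hγ : (γ : 𝒪[v.adicCompletion K]) = 1 + π ^ 2 * w) (_ : ((γ : 𝒪[v.adicCompletion K]) : v.adicCompletion K) = ((α₁ : K) : v.adicCompletion K))
      (_ : lubinTateChar hπ (σ a₁) = γ)
      (_ : π ^ 2 ∣ ((Ideal.absNorm (a₁.1 : Ideal (𝓞 K)) : ℕ) : 𝒪[v.adicCompletion K]) - 1)
      (_ : ((Ideal.absNorm (a₁.1 : Ideal (𝓞 K)) : ℕ) : 𝒪[v.adicCompletion K]) ≠ (γ : 𝒪[v.adicCompletion K]) ^ 2)
      (_ : ((Ideal.absNorm (a₂.1 : Ideal (𝓞 K)) : ℕ) : 𝒪[v.adicCompletion K]) = (lubinTateChar hπ (σ a₂) : 𝒪[v.adicCompletion K]) ^ 2)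
      (_ : lubinTateChar hπ (σ a₂) ≠ 1) (_ : lubinTateChar hπ (σ a₂) ≠ -1)
    (_ : ∀ b : {𝔞 : Ideal (𝓞 K) // IsLocArtinLiftable (𝔤₀ * v'.asIdeal ^ ν) v v' 𝔞}, colemanDeltaCoinvFun hπ hq (intBase (v.adicCompletion K)) u hu γ (eq_zero_of_C_pi_mul_eq_zero_integer hπ) w hγ ε
        (indexTraceₗ hπ hq u hu γ (colemanImage hd hπ E hmono hE hdeg hσ₀ hq u hu γ hθ hcoh
          (closure_unitsGen_subset_principalCoherentFamilies hπ E hmono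
            (fun b ↦ ellipticUnitsPrincipal₂ h24iii h25 hK ιK
                (mul_ne_zero h𝔤0 (pow_ne_zero ν v'.ne_bot))
                (not_mul_pow_le₃₄ hv hvv' ν) hvv'
                (hw_of_towerData hw𝔤) hπ
                (towerData_hα0 (p := p) hα0)
                (towerData_hα𝔪 hv' hp.out hpv' hpv'2 hα𝔤 ha2 hαa)
                (towerData_hαw (p := p) hαw)
                (towerData_hαπ (p := p) hαπ) E hmono (r + 1) (fun i ↦ hE (i + (r + 1)))
                (towerDataOffset_hdegE hf E hE hdeg)
              b.2.1 b.2.2.1 (x b) (hx b))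
            (fun b ↦ ellipticUnitsPrincipal₂_mem_principalCoherentFamilies h24iii h25 hK ιK
                (mul_ne_zero h𝔤0 (pow_ne_zero ν v'.ne_bot))
                (not_mul_pow_le₃₄ hv hvv' ν) hvv'
                (hw_of_towerData hw𝔤) hπ
                (towerData_hα0 (p := p) hα0)
                (towerData_hα𝔪 hv' hp.out hpv' hpv'2 hα𝔤 ha2 hαa)
                (towerData_hαw (p := p) hαw)
                (towerData_hαπ (p := p) hαπ) E hmono (r + 1)
              (fun i ↦ hE (i + (r + 1)))
                  (towerDataOffset_hdegE hf E hE hdeg) b.2.1 b.2.2.1 (fun i ↦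
                  (towerDataOffset_hinert_of_level h𝔤0 hv hv' hvv' hw𝔤 hp.out hpv' hpv'2 hπ hα0 hα𝔤 hαf hℓ hαℓ ha2 hαa hfo E hE (r + 1) (finrank_add_offset_eq E hf hdeg)) (i + 1))
                  (towerDataOffset_hcount h𝔤0 hv' hvv' hw𝔤 hp.out hdeg1 hpv' hpv'2 E hdeg) (x b) (hx b))
            (mem_closure_unitsGen hπ E _ b)).1)) =
      (colemanDeltaCoinvFun hπ hq (intBase (v.adicCompletion K)) u hu γ (eq_zero_of_C_pi_mul_eq_zero_integer hπ) w hγ ε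
          (unitTwistₗ hπ hq (intBase (v.adicCompletion K)) u hu γ (lubinTateChar hπ (σ b)) (TActModule.ofPS _ _ 1)) *
          PowerSeries.C (g b : PowerSeries 𝒪[v.adicCompletion K]) - PowerSeries.C ((Ideal.absNorm (b.1 : Ideal (𝓞 K)) : ℕ) : PowerSeries 𝒪[v.adicCompletion K])) * L),
    ∀ (mm kk : ℕ) [IsAdicComplete (Ideal.span {algebraMap (LTCoeff (v.adicCompletion K)) (unitBall (E mm)) (LTCoeff.of (v.adicCompletion K) π)})
      (unitBall (E mm))]
    (hεk : PowerSeries.map ((algebraMap 𝒪[v.adicCompletion K] (unitBall (E mm))).comp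
      (PowerSeries.constantCoeff (R := 𝒪[v.adicCompletion K]))) ε = (-1) ^ (kk + 1))
    (hmom : ∑ τ : E mm ≃ₐ[v.adicCompletion K] E mm, unitBallEquiv (E mm) τ (coordMoment hπ (E mm) u kk
      (relUnitCoordTwo hπ (E mm) hq (hE mm) hσ₀ u hu
        (extendDown hπ E hmono (r + 1) (ellipticUnitsLocal₂ h24iii h25 hK ιK
                    (mul_ne_zero h𝔤0 (pow_ne_zero ν v'.ne_bot))
                    (not_mul_pow_le₃₄ hv hvv' ν) hvv'
                    (hw_of_towerData hw𝔤) hπ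
                    (towerData_hα0 (p := p) hα0)
                    (towerData_hα𝔪 hv' hp.out hpv' hpv'2 hα𝔤 ha2 hαa)
                    (towerData_hαw (p := p) hαw)
                    (towerData_hαπ (p := p) hαπ) (fun i ↦ E (i + (r + 1)))
                  (fun i ↦ hE (i + (r + 1)))
                      (towerDataOffset_hdegE hf E hE hdeg) a₁.2.1 a₁.2.2.1 (x a₁) (hx a₁)) mm))) ≠ 0),
        Module.charIdeal (PowerSeries (PowerSeries 𝒪[v.adicCompletion K]))
        (↥(unitsImageTrace hd hπ E hmono hE hdeg hσ₀ hq u hu γ hθ hcoh hI hud) ⧸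
          colemanCoinvRel hπ hq (intBase (v.adicCompletion K)) u hu γ ε (unitsImageTrace hd hπ E hmono hE hdeg hσ₀ hq u hu γ hθ hcoh hI hud)
            (fun _ hG => unitTwistₗ_mem_unitsImageTrace hd hπ E hmono hE hdeg hσ₀ hq u hu γ hθ hcoh hI hud (-1) hG)
            (colemanImageTrace hd hπ E hmono hE hdeg hσ₀ hq u hu γ hθ hcoh hN
              (closure (Submonoid.closure
                (Set.range (fun b ↦ ellipticUnitsPrincipal₂ h24iii h25 hK ιK
                    (mul_ne_zero h𝔤0 (pow_ne_zero ν v'.ne_bot))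
                    (not_mul_pow_le₃₄ hv hvv' ν) hvv'
                    (hw_of_towerData hw𝔤) hπ
                    (towerData_hα0 (p := p) hα0)
                    (towerData_hα𝔪 hv' hp.out hpv' hpv'2 hα𝔤 ha2 hαa)
                    (towerData_hαw (p := p) hαw)
                    (towerData_hαπ (p := p) hαπ) E hmono (r + 1) (fun i ↦ hE (i + (r + 1)))
                  (towerDataOffset_hdegE hf E hE hdeg) b.2.1 b.2.2.1 (x b) (hx b)) ∪
                  Set.range fun b ↦ fun j ↦ (ellipticUnitsPrincipal₂ h24iii h25 hK ιK
                      (mul_ne_zero h𝔤0 (pow_ne_zero ν v'.ne_bot))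
                      (not_mul_pow_le₃₄ hv hvv' ν) hvv'
                      (hw_of_towerData hw𝔤) hπ
                      (towerData_hα0 (p := p) hα0)
                      (towerData_hα𝔪 hv' hp.out hpv' hpv'2 hα𝔤 ha2 hαa)
                      (towerData_hαw (p := p) hαw)
                      (towerData_hαπ (p := p) hαπ) E hmono (r + 1)
                    (fun i ↦ hE (i + (r + 1))) (towerDataOffset_hdegE hf E hE hdeg) b.2.1 b.2.2.1 (x b) (hx b) j).inv hπ (E j)) :
                Set (∀ j, RelNormCoherentUnits hπ (E j))))
              isClosed_closure
              (closure_unitsGen_subset_principalCoherentFamilies hπ E hmono _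
                (fun b ↦ ellipticUnitsPrincipal₂_mem_principalCoherentFamilies h24iii h25 hK ιK
                    (mul_ne_zero h𝔤0 (pow_ne_zero ν v'.ne_bot))
                    (not_mul_pow_le₃₄ hv hvv' ν) hvv'
                    (hw_of_towerData hw𝔤) hπ
                    (towerData_hα0 (p := p) hα0)
                    (towerData_hα𝔪 hv' hp.out hpv' hpv'2 hα𝔤 ha2 hαa)
                    (towerData_hαw (p := p) hαw)
                    (towerData_hαπ (p := p) hαπ) E hmono (r + 1)
                  (fun i ↦ hE (i + (r + 1)))
                      (towerDataOffset_hdegE hf E hE hdeg) b.2.1 b.2.2.1 (fun i ↦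
                      (towerDataOffset_hinert_of_level h𝔤0 hv hv' hvv' hw𝔤 hp.out hpv' hpv'2 hπ hα0 hα𝔤 hαf hℓ hαℓ ha2 hαa hfo E hE (r + 1) (finrank_add_offset_eq E hf hdeg)) (i + 1))
                      (towerDataOffset_hcount h𝔤0 hv' hvv' hw𝔤 hp.out hdeg1 hpv' hpv'2 E hdeg) (x b) (hx b)))
              (one_mem_closure_unitsGen hπ E _) (mul_mem_closure_unitsGen hπ E _) (inv_mem_closure_unitsGen hπ E _)
              (galAct_mem_closure_unitsGen hπ E _ (galAct_mem_closure_unitsGen_of_mul_rule hπ E hmono _ σ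
                (happrox_of_isLocArtinLiftable
                    (mul_ne_zero h𝔤0 (pow_ne_zero ν v'.ne_bot))
                    (not_mul_pow_le₃₄ hv hvv' ν) hvv'
                    (hw_of_towerData hw𝔤) hπ
                    (towerData_hα0 (p := p) hα0)
                    (towerData_hα𝔪 hv' hp.out hpv' hpv'2 hα𝔤 ha2 hαa)
                    (towerData_hαw (p := p) hαw)
                    (towerData_hαπ (p := p) hαπ) E hmono hE (r + 1)
                    (towerDataOffset_hdegE hf E hE hdeg)
                    (towerDataOffset_hinert_of_level h𝔤0 hv hv' hvv' hw𝔤 hp.out hpv' hpv'2 hπ hα0 hα𝔤 hαf hℓ hαℓ ha2 hαa hfo E hE (r + 1) (finrank_add_offset_eq E hf hdeg))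
                    (towerDataOffset_hcount h𝔤0 hv' hvv' hw𝔤 hp.out hdeg1 hpv' hpv'2 E hdeg) σ hσ)
                (fun a b ↦ ⟨a.1 * b.1, a.2.mul b.2⟩)
                (fun b ↦ Ideal.absNorm (b.1 : Ideal (𝓞 K)))
                (hrule_ellipticUnitsPrincipal₂ h24iii h25 hK ιK
                    (mul_ne_zero h𝔤0 (pow_ne_zero ν v'.ne_bot))
                    (not_mul_pow_le₃₄ hv hvv' ν) hvv'
                    (hw_of_towerData hw𝔤) hπ
                    (towerData_hα0 (p := p) hα0)
                    (towerData_hα𝔪 hv' hp.out hpv' hpv'2 hα𝔤 ha2 hαa)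
                    (towerData_hαw (p := p) hαw)
                    (towerData_hαπ (p := p) hαπ) E hmono (r + 1) (fun i ↦ hE (i + (r + 1)))
                    (towerDataOffset_hdegE hf E hE hdeg) h24ii
                  Subtype.val (fun a b ↦ ⟨a.1 * b.1, a.2.mul b.2⟩) (fun _ _ ↦ rfl) (fun a ↦ a.2.1) (fun a ↦ a.2.2.1) x hx σ hσ))))) =
      Ideal.span {L} := by
  obtain ⟨hw𝔤, hdeg1, hpv'2, hCZ, σ₀, hσ₀, hq, hAC, hI, hN, π, hπ, α, hα0, hα𝔤, hαw, f, hαf, hαπ, ℓ, ν, hℓ, hαℓ, ha2, hαa, d₀, r, hd, hf, hfo,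
    u, hu, hd₀, hm, hT⟩ :=
    exists_frame_charIdeal_coinvariants_colemanImageTrace_closure_ellipticUnits_eq_span_of_ellipticUnits_moment_of_split h24iii h25 h24ii hK ιK
      h𝔤0 hv hv' hvv' h2𝔤 hp2 hpv hpv' hcl
  refine ⟨hw𝔤, hdeg1, hpv'2, hCZ, σ₀, hσ₀, hq, hAC, hI, hN, π, hπ, α, hα0, hα𝔤, hαw, f, hαf, hαπ, ℓ, ν, hℓ, hαℓ, ha2, hαa, d₀, r, hd, hf, hfo,
    u, hu, hd₀, hm, ?_⟩
  intro E _ _ _ hmono hE hdeg _ θ hθ hcoh hud x hx σ hσ ε g s hg hε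
  haveI := hCZ
  haveI := hAC
  haveI := hd₀
  subst hp2
  -- ### (A) the auxiliary indices by the principal road
  obtain ⟨α₁, ϱ, h₁, h₂, γ, w, hα₁𝔪, hϱ𝔪, hγ, hγK, hv₁, hn₁π, hne, hn₂, hv₂, hv₂'⟩ :=
    exists_principal_witnesses hK.1 (mul_ne_zero h𝔤0 (pow_ne_zero ν v'.ne_bot)) (not_mul_pow_le₃₄ hv hvv' ν) hvv' (hw_of_towerData hw𝔤)
      hpv hpv' hπ (two_eq_uniformizer_mul_units_inv hq u hu) (towerData_hα0 (p := 2) hα0) (towerData_hα𝔪 hv' hp.out hpv' hpv'2 hα𝔤 ha2 hαa)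
      (towerData_hαw (p := 2) hαw) (towerData_hαπ (p := 2) hαπ) E hmono hE (r + 1) (towerDataOffset_hdegE hf E hE hdeg)
      (towerDataOffset_hinert_of_level h𝔤0 hv hv' hvv' hw𝔤 hp.out hpv' hpv'2 hπ hα0 hα𝔤 hαf hℓ hαℓ ha2 hαa hfo E hE (r + 1)
        (finrank_add_offset_eq E hf hdeg))
      (towerDataOffset_hcount h𝔤0 hv' hvv' hw𝔤 hp.out hdeg1 hpv' hpv'2 E hdeg) σ hσ
  -- ### (B) the Amice consequences
  have hg₁ : PowerSeries.constantCoeff (g ⟨Ideal.span {α₁}, h₁⟩ : PowerSeries 𝒪[v.adicCompletion K]) = 1 :=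
    constantCoeff_eq_one_of_amice E (p := 2) (hg ⟨Ideal.span {α₁}, h₁⟩)
  have hg₂ : PowerSeries.constantCoeff (g ⟨Ideal.span {(ϱ : 𝓞 K)}, h₂⟩ : PowerSeries 𝒪[v.adicCompletion K]) = 1 :=
    constantCoeff_eq_one_of_amice E (p := 2) (hg ⟨Ideal.span {(ϱ : 𝓞 K)}, h₂⟩)
  have hn₁' : (π : 𝒪[v.adicCompletion K]) ∣ ((Ideal.absNorm (Ideal.span {α₁}) : ℕ) : 𝒪[v.adicCompletion K]) - 1 :=
    (dvd_pow_self π two_ne_zero).trans hn₁π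
  have hn₁ := natCast_mul_inv_sub_one_mem_maximalIdeal hπ hn₁' (g ⟨Ideal.span {α₁}, h₁⟩) hg₁
  -- ### (C) the divided series `L` (existence form of the trace capstone; `ha₂` by the kernel theorem)
  obtain ⟨L, hL, -⟩ := exists_charIdeal_coinvariants_colemanImageTrace_closure_eq_span_of_mul_rule hd hπ E hmono hE hdeg hσ₀ hq u hu γ w hγ
    hθ hcoh hI hud hm hN
    (fun b ↦ ellipticUnitsPrincipal₂ h24iii h25 hK ιK
        (mul_ne_zero h𝔤0 (pow_ne_zero ν v'.ne_bot))
        (not_mul_pow_le₃₄ hv hvv' ν) hvv'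
        (hw_of_towerData hw𝔤) hπ
        (towerData_hα0 (p := 2) hα0)
        (towerData_hα𝔪 hv' hp.out hpv' hpv'2 hα𝔤 ha2 hαa)
        (towerData_hαw (p := 2) hαw)
        (towerData_hαπ (p := 2) hαπ) E hmono (r + 1) (fun i ↦ hE (i + (r + 1)))
        (towerDataOffset_hdegE hf E hE hdeg)
      b.2.1 b.2.2.1 (x b) (hx b))
    (fun b ↦ ellipticUnitsPrincipal₂_mem_principalCoherentFamilies h24iii h25 hK ιK
        (mul_ne_zero h𝔤0 (pow_ne_zero ν v'.ne_bot))
        (not_mul_pow_le₃₄ hv hvv' ν) hvv'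
        (hw_of_towerData hw𝔤) hπ
        (towerData_hα0 (p := 2) hα0)
        (towerData_hα𝔪 hv' hp.out hpv' hpv'2 hα𝔤 ha2 hαa)
        (towerData_hαw (p := 2) hαw)
        (towerData_hαπ (p := 2) hαπ) E hmono (r + 1)
      (fun i ↦ hE (i + (r + 1)))
          (towerDataOffset_hdegE hf E hE hdeg) b.2.1 b.2.2.1 (fun i ↦
          (towerDataOffset_hinert_of_level h𝔤0 hv hv' hvv' hw𝔤 hp.out hpv' hpv'2 hπ hα0 hα𝔤 hαf hℓ hαℓ ha2 hαa hfo E hE (r + 1)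
            (finrank_add_offset_eq E hf hdeg)) (i + 1))
          (towerDataOffset_hcount h𝔤0 hv' hvv' hw𝔤 hp.out hdeg1 hpv' hpv'2 E hdeg) (x b) (hx b))
    ε σ g (fun b ↦ Ideal.absNorm (b.1 : Ideal (𝓞 K))) (fun a b ↦ ⟨a.1 * b.1, a.2.mul b.2⟩) (fun a b ↦ Subtype.ext (mul_comm _ _))
    (hrule_ellipticUnitsPrincipal₂ h24iii h25 hK ιK
        (mul_ne_zero h𝔤0 (pow_ne_zero ν v'.ne_bot))
        (not_mul_pow_le₃₄ hv hvv' ν) hvv'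
        (hw_of_towerData hw𝔤) hπ
        (towerData_hα0 (p := 2) hα0)
        (towerData_hα𝔪 hv' hp.out hpv' hpv'2 hα𝔤 ha2 hαa)
        (towerData_hαw (p := 2) hαw)
        (towerData_hαπ (p := 2) hαπ) E hmono (r + 1) (fun i ↦ hE (i + (r + 1)))
        (towerDataOffset_hdegE hf E hE hdeg) h24ii
      Subtype.val (fun a b ↦ ⟨a.1 * b.1, a.2.mul b.2⟩) (fun _ _ ↦ rfl) (fun a ↦ a.2.1) (fun a ↦ a.2.2.1) x hx σ hσ)
    (happrox_of_isLocArtinLiftable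
        (mul_ne_zero h𝔤0 (pow_ne_zero ν v'.ne_bot))
        (not_mul_pow_le₃₄ hv hvv' ν) hvv'
        (hw_of_towerData hw𝔤) hπ
        (towerData_hα0 (p := 2) hα0)
        (towerData_hα𝔪 hv' hp.out hpv' hpv'2 hα𝔤 ha2 hαa)
        (towerData_hαw (p := 2) hαw)
        (towerData_hαπ (p := 2) hαπ) E hmono hE (r + 1)
        (towerDataOffset_hdegE hf E hE hdeg)
        (towerDataOffset_hinert_of_level h𝔤0 hv hv' hvv' hw𝔤 hp.out hpv' hpv'2 hπ hα0 hα𝔤 hαf hℓ hαℓ ha2 hαa hfo E hE (r + 1)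
          (finrank_add_offset_eq E hf hdeg))
        (towerDataOffset_hcount h𝔤0 hv' hvv' hw𝔤 hp.out hdeg1 hpv' hpv'2 E hdeg) σ hσ)
    hε s hg ⟨Ideal.span {α₁}, h₁⟩ ⟨Ideal.span {(ϱ : 𝓞 K)}, h₂⟩ hv₁ hn₁'
    (maxEval_twistFactor_ne_zero_of_natCast_eq_pow hπ hq u hu γ w hγ ε hε (g ⟨Ideal.span {α₁}, h₁⟩) (g ⟨Ideal.span {(ϱ : 𝓞 K)}, h₂⟩)
      hg₁ hg₂ _ hn₁π hne hn₂ hv₂ hv₂')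
  -- ### assembly: T15-split with the supplied binders
  refine ⟨α₁, ϱ, ⟨Ideal.span {α₁}, h₁⟩, ⟨Ideal.span {(ϱ : 𝓞 K)}, h₂⟩, γ, w, L, rfl, hα₁𝔪, rfl, hϱ𝔪, hγ, hγK, hv₁, hn₁π, hne, hn₂, hv₂, hv₂',
    hL, ?_⟩
  intro mm kk _ hεk hmom
  exact hT E hmono hE hdeg γ w hγ hθ hcoh hud x hx σ hσ ε g hε ⟨Ideal.span {α₁}, h₁⟩ ⟨Ideal.span {(ϱ : 𝓞 K)}, h₂⟩ hv₁ hn₁ hg₁ hg₂ hn₁π hne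
    hn₂ hv₂ hv₂' mm kk hεk hmom L hL

end Capstone

end Summit.BirchSwinnertonDyer.BirchSwinnertonDyer.Theorems.PrintCf2.ColemanCoinvariantTraceEllipticUnitsResidualDischarged

end
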